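import Summits.HodgeConjecture.HodgeConjecture.Theorems.Ring2SemiregularRepresentativesVHC
import HarnessLib

/-!
# Ring 2 — road b02 (D-0059): the typed crux K-SR `SemiregularSheafRepresentatives` is VACUOUS given
`AbelianSchemeVHC` (a negative lemma on the TYPING of brief v2.1 `VHCAbelianSchemesRoad`)

research route conditional on HC_CM; not a corollary; Q11.4-sentence-2 already refuted in dim ≥ 3.

Mathematics and Lean text: cell `vhodge`, seat P4 g7 (planner-vhodge-p4-g7-0), memo file
`run/shared/lean/pub/vhodge/memos/ROUTE-P4-g7-KSR_vacuity_certificate.lean` (sha256/16 d988108f85244cbe),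
re-homed VERBATIM to the ring-2 namespace `Ring2.SemiregularRepresentatives` by ring2 LEAD gen 145
(planner-pub-hodge-ring2-typer1-g143-0) on director-hodge's ruling «2026-08-25T20:41:20Z» (3); nothing is
asserted: every `@[conjecture] def` of the tree stays a HYPOTHESIS, `HC_CM` occurs nowhere.

THE FINDING. In `Ring2.SemiregularRepresentatives.AdmissibleRepresentatives 𝒪` (landed p406571) the global
correction `Z` is only required to be FIBREWISE ALGEBRAIC. If `W` itself is fibrewise algebraic — which is
exactly what `AbelianSchemeVHC` delivers from the binders (`W` fibrewise rational `(p,p)`, algebraic at `s₀`) —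
then `I := {p}`, `κ := 0`, `V := 0`, `a := 1`, `Z := -W` and the NULL CARRIER (the zero sheaf: finite locally
free of rank `0`, `I`-semiregular because `Ext²(0,0) = 0`, `ch(0) = 0`) witness the conclusion. Hence

  `AbelianSchemeVHC → SemiregularSheafRepresentatives`     (`semiregularSheafRepresentatives_of_abelianSchemeVHC`)

and with the landed chain `SemiregularSheafRepresentatives → AbelianSchemeVHC → HC_AV` (mod K-C, BF Thm 5.1,
the curve residual, André 1996) the brief's single research crux K-SR is EQUIVALENT to `AbelianSchemeVHC`,
i.e. to `HC_AV` modulo print (`hc_av_iff_semiregularSheafRepresentatives`). A route v2.1 whose only open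
mathematical crux is K-SR therefore restates the summit conjunct; the repair (v2.2, K-SR♭: the correction
constrained fibrewise to the divisor-class span, Bloch 1972 Rem. (7.5) literally) is typed separately.

References: [cite: BuchweitzFlenner2003, §5 Thm. 5.1] [cite: Andre1996Motifs, §6.3 Lemmes 6.3.1–6.3.3]
[cite: Bloch1972Semiregularity, Rem. 7.5] [cite: Fulton1998, Example 3.2.3].
-/

noncomputable section

open CategoryTheory CategoryTheory.Abelian CategoryTheory.Limits AlgebraicGeometry Topology ZeroObject

namespace Summit.HodgeConjecture.HodgeConjecture.Ring2.SemiregularRepresentatives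

set_option linter.dupNamespace false

open Literature.AlgebraicGeometry Literature.AlgebraicGeometry.Motives
open Literature.AlgebraicGeometry.HodgeTheory
open Literature.AlgebraicTopology.SingularHomology
open Literature.AlgebraicGeometry.Andre1996 (andre1996_cmAnchoredPencil
  andre1996_cmHodgeClasses_algebraicallyAnchoredPencils)
open Summit.HodgeConjecture.HodgeConjecture.Ring2.Hypotheses (AbelianSchemeVHC abelianSchemeVHC_of_hc_av
  abelianSchemeVHC_of_hodgeConjecture)
open Summit.HodgeConjecture.HodgeConjecture.Ring2.Binders
open Summit.HodgeConjecture.HodgeConjecture.Ring2.SemiregularRepresentatives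
open Summit.Ventures.HSemireg (ObjClass LocalVariationalHodgeFor bfSheafClass
  localVariationalHodgeFor_bfSheafClass)

/-! ## §1 Null data of an object class -/

/-- An object class `𝒪` **has null data** if the zero family `κ = 0` on the single degree `{p}` is
`𝒪`-admissible on every `ℂ`-scheme, in every relative dimension. [folklore] -/
def HasNullDatum (𝒪 : ObjClass) : Prop :=
  ∀ (n : ℕ) (X₀ : SchemeOver ℂ) (p : ℕ), 𝒪 n X₀ {p} (fun _ => 0)

section Sigma

universe w u

variable {R : Type u} [CommRing R] {X : Over (Spec (CommRingCat.of R))}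
variable {E : X.left.Modules} [HasExt.{w} X.left.Modules]

/-- **A zero module is `I`-semiregular for every `I`**: `Ext²(E,E) = 0` when `E ≅ 0`
(`x = 𝟙_E · x = 0 · x = 0`). [folklore] -/
theorem isISemiregular_of_isZero (hz : IsZero E) (hE : IsFiniteLocallyFree E) (I : Set ℕ) :
    IsISemiregular.{w} hE I := by
  intro x _
  have h1 : (𝟙 E : E ⟶ E) = 0 := hz.eq_of_src _ _
  calc x = (Ext.mk₀ (𝟙 E)).comp x (zero_add 2) := (Ext.mk₀_id_comp x).symm
    _ = 0 := by rw [h1, Ext.mk₀_zero, Ext.zero_comp]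

end Sigma

/-- **The Buchweitz–Flenner sheaf class has null data**: the zero sheaf is finite locally free,
`I`-semiregular, and `ch_q(0) = 0` in every Chern character theory `C`. [folklore]
[cite: Fulton1998, Example 3.2.3] -/
theorem hasNullDatum_bfSheafClass (C : ChernCharacterBetti) : HasNullDatum (bfSheafClass C) := by
  intro n X₀ p
  refine ⟨0, (hasRankLE_zero_of_isZero (isZero_zero _)).isFiniteLocallyFree,
    isISemiregular_of_isZero (isZero_zero _) _ _, fun q _ => ?_⟩
  exact (C.ch_eq_zero_of_isZero (isZero_zero _) q).symm

/-! ## §2 The vacuity: `AbelianSchemeVHC` gives admissible representatives for every class with null data -/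

/-- **`AbelianSchemeVHC → AdmissibleRepresentatives 𝒪`** for every object class with null data.
Witness: `I = {p}`, `κ = 0`, `V = 0`, `a = 1`, `Z = -W` (fibrewise algebraic BECAUSE `W` is, by
`AbelianSchemeVHC` applied to the binders). [folklore] -/
theorem admissibleRepresentatives_of_abelianSchemeVHC {𝒪 : ObjClass} (h𝒪 : HasNullDatum 𝒪)
    (h : AbelianSchemeVHC) : AdmissibleRepresentatives 𝒪 := by
  intro n 𝒳 S f hf h𝒳 hirr haff hsm hdim habel he p W hW s₀ hs₀
  have halg : ∀ s : ComplexPoints S,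
      complexBetti.map (fiberι f s) (2 * p) W ∈ algebraicClasses (fiberOver f s) p :=
    h f hf hirr hsm habel p W hW ⟨s₀, hs₀⟩
  refine ⟨{p}, fun _ => 0, fun _ => 0, 1, -W, Finset.mem_singleton_self p, h𝒪 n _ p, one_ne_zero,
    fun s => ?_, ?_, fun q _ => ?_, fun q _ s => ?_⟩
  · rw [map_neg]
    exact Submodule.neg_mem _ (halg s)
  · rw [one_smul, add_neg_cancel]
  · rw [map_zero]
  · obtain ⟨A, -⟩ := (hW s).2
    rw [map_zero]
    exact IsOfHodgeType.zero A _ _ _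

/-- **K-SR is implied by row b02**: `AbelianSchemeVHC → SemiregularSheafRepresentatives`. -/
theorem semiregularSheafRepresentatives_of_abelianSchemeVHC (h : AbelianSchemeVHC) :
    SemiregularSheafRepresentatives :=
  fun C => admissibleRepresentatives_of_abelianSchemeVHC (hasNullDatum_bfSheafClass C) h

/-- **K-SR is implied by `HC_AV`** (the H1 rung `Theses.PadicSemiregularLift.HodgeAbelianVarieties`). -/
theorem semiregularSheafRepresentatives_of_hc_av (h : Theses.PadicSemiregularLift.HodgeAbelianVarieties) :
    SemiregularSheafRepresentatives :=
  semiregularSheafRepresentatives_of_abelianSchemeVHC (abelianSchemeVHC_of_hc_av h)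

/-- **K-SR is implied by the Hodge conjecture.** -/
theorem semiregularSheafRepresentatives_of_hodgeConjecture (h : _root_.HodgeConjecture) :
    SemiregularSheafRepresentatives :=
  semiregularSheafRepresentatives_of_abelianSchemeVHC (abelianSchemeVHC_of_hodgeConjecture h)

/-! ## §3 The equivalences (T1(a) one level down) -/

/-- **K-SR ⟺ row b02** modulo the brief's construction item K-C, BF Thm. 5.1 (tree fact) and the curve
residual. [cite: BuchweitzFlenner2003, §5 Thm. 5.1] -/
theorem abelianSchemeVHC_iff_semiregularSheafRepresentatives (hC : ChernCharacterOnBetti)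
    (hBF : BuchweitzFlenner2003_variationalHodge_ISemiregular_model)
    (hqp : OneParameterAbelianSchemeQuasiProjective) :
    AbelianSchemeVHC ↔ SemiregularSheafRepresentatives :=
  ⟨semiregularSheafRepresentatives_of_abelianSchemeVHC,
    fun hSR => abelianSchemeVHC_of_semiregularSheafRepresentatives hC hSR hBF hqp⟩

/-- **K-SR ⟺ `HC_AV`** modulo K-C, BF Thm. 5.1, the curve residual and André 1996 Lemmes 6.3.1–6.3.3:
the v2.1 brief's only research crux is summit-conjunct-equivalent modulo print.
[cite: BuchweitzFlenner2003, §5 Thm. 5.1] [cite: Andre1996Motifs, §6.3 Lemmes 6.3.1–6.3.3] -/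
theorem hc_av_iff_semiregularSheafRepresentatives (hC : ChernCharacterOnBetti)
    (hBF : BuchweitzFlenner2003_variationalHodge_ISemiregular_model)
    (hqp : OneParameterAbelianSchemeQuasiProjective) (h₂₁ : andre1996_cmAnchoredPencil)
    (h₂₂ : andre1996_cmHodgeClasses_algebraicallyAnchoredPencils) :
    Theses.PadicSemiregularLift.HodgeAbelianVarieties ↔ SemiregularSheafRepresentatives :=
  ⟨semiregularSheafRepresentatives_of_hc_av,
    fun hSR => hc_av_of_semiregularSheafRepresentatives hC hSR hBF hqp h₂₁ h₂₂⟩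

/-- Sanity: the germ-node reading too — `AbelianSchemeVHC` gives admissible representatives for ANY door
with null data, so `AdmissibleRepresentatives 𝒪 ∧ LocalVariationalHodgeFor 𝒪` for such `𝒪` carries no
content beyond row b02 itself. -/
example {𝒪 : ObjClass} (h𝒪 : HasNullDatum 𝒪) (h : Theses.PadicSemiregularLift.HodgeAbelianVarieties) :
    AdmissibleRepresentatives 𝒪 :=
  admissibleRepresentatives_of_abelianSchemeVHC h𝒪 (abelianSchemeVHC_of_hc_av h)

end Summit.HodgeConjecture.HodgeConjecture.Ring2.SemiregularRepresentatives

end
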